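import Mathlib
import Summits.Ventures.HodgeRepro2.T5HeckeDoubleCosetBasis

/-!
# The image of `H(G, K)` in `End_k(V^K)` is spanned by the operators `e_K ρ(g) e_K`

Blind cell `pub-hodge-repro2`, seat p8 (gen 8), Tier-5 kernel support.  `T5HeckePermutationModule`
(T5-52) lets `H(G, K) = End_G(k[G ⧸ K])` act on `V^K` (`heckeAction`), `T5HeckeDoubleCoset` (T5-53)
identifies the double-coset element `T_g` with `#(KgK/K) · e_K ρ(g) e_K` (T5-46's `heckeOp`), and
`T5HeckeDoubleCosetBasis` (T5-54) shows that the `T_g` form a basis of `H(G, K)` when every double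
coset is a finite union of left cosets.  Together:

* `heckeEnd_heckeAlgebraBasis'` — the basis element of `KgK` acts on `V^K` as `#(KgK/K) · heckeOp g`;
* `range_heckeAction_eq_span_heckeOp` — THE IMAGE OF `H(G, K)` IN `End_k(V^K)` IS THE SPAN OF THE
  OPERATORS `e_K ρ(g) e_K`, `g ∈ G` (characteristic `0`, `ρ` `K`-finite, every `KgK/K` finite — e.g.
  `K` compact open);
* `heckeOp_mem_range_heckeAction` — each `e_K ρ(g) e_K` is the action of an element of `H(G, K)`.

In the record: «`H(G, K)` acts on `π^K` through the double-coset operators `e_K π(g) e_K`, and the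
`H(G, K)`-module structure of `π^K` is the one of T5-46's operators» — closed in kernel form; what
stays prose: the Haar normalisation and the printed theorems.

README §8(d): uses an L-value-free non-vanishing device: NO.
-/

namespace Summit.Ventures.HodgeRepro2.T5HeckeActionRange

noncomputable section

open Summit.Ventures.HodgeRepro2.LevelPositivity
open Summit.Ventures.HodgeRepro2.T5LevelIdempotent
open Summit.Ventures.HodgeRepro2.T5HeckeOperator
open Summit.Ventures.HodgeRepro2.T5HeckePermutationModule
open Summit.Ventures.HodgeRepro2.T5HeckeDoubleCoset
open Summit.Ventures.HodgeRepro2.T5HeckeDoubleCosetBasis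
open MulAction

variable {G : Type*} [Group G] {k : Type*} [Field k] {V : Type*} [AddCommGroup V] [Module k V]
  (ρ : Representation k G V) {K : Subgroup G} [CharZero k]

/-- Every `K`-orbit on `G ⧸ K` is the orbit of a coset `gK`. -/
theorem exists_orbit_eq (ω : orbitRel.Quotient K (G ⧸ K)) :
    ∃ g : G, (Quotient.mk'' (g : G ⧸ K) : orbitRel.Quotient K (G ⧸ K)) = ω := by
  induction ω using Quotient.inductionOn' with
  | h x =>
    induction x using QuotientGroup.induction_on with
    | H g => exact ⟨g, rfl⟩

/-- The action of the double-coset element `T_g` on `V^K` is `#(KgK/K) · e_K ρ(g) e_K`. -/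
theorem heckeEnd_doubleCosetOp (hK : KFinite ρ K) (g : G) [Finite (orbit K (g : G ⧸ K))] :
    heckeEnd ρ (doubleCosetOp k K g) = ((orbit K (g : G ⧸ K)).ncard : k) • heckeOp ρ hK g := by
  have hn : ((orbit K (g : G ⧸ K)).ncard : k) ≠ 0 := by
    exact_mod_cast ((Set.ncard_pos (Set.toFinite _)).mpr ⟨_, mem_orbit_self _⟩).ne'
  ext v
  rw [heckeEnd_apply, LinearMap.smul_apply, heckeOp_eq_inv_ncard_smul, smul_smul,
    mul_inv_cancel₀ hn, one_smul]

/-- The basis element of the double coset `KgK` acts on `V^K` as `#(KgK/K) · e_K ρ(g) e_K`. -/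
theorem heckeEnd_heckeAlgebraBasis' (hK : KFinite ρ K)
    (hfin : ∀ ω : orbitRel.Quotient K (G ⧸ K), ω.orbit.Finite)
    (ω : orbitRel.Quotient K (G ⧸ K)) (g : G)
    (hg : (Quotient.mk'' (g : G ⧸ K) : orbitRel.Quotient K (G ⧸ K)) = ω) :
    heckeEnd ρ (heckeAlgebraBasis' k K hfin ω) =
      ((orbit K (g : G ⧸ K)).ncard : k) • heckeOp ρ hK g := by
  haveI : Finite (orbit K (g : G ⧸ K)) := by
    have := hfin ω
    rw [← hg, orbitRel.Quotient.orbit_mk] at this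
    exact this
  rw [heckeAlgebraBasis', Module.Basis.reindex_apply,
    heckeAlgebraBasis_eq_doubleCosetOp k K _ g (by exact hg), heckeEnd_doubleCosetOp ρ hK g]

/-- Each `e_K ρ(g) e_K` is the action of an element of `H(G, K)` (of `#(KgK/K)⁻¹ · T_g`). -/
theorem heckeOp_mem_range_heckeAction (hK : KFinite ρ K) (g : G)
    [Finite (orbit K (g : G ⧸ K))] :
    heckeOp ρ hK g ∈ LinearMap.range (heckeAction ρ (K := K)).toLinearMap := by
  refine ⟨MulOpposite.op (((orbit K (g : G ⧸ K)).ncard : k)⁻¹ • doubleCosetOp k K g), ?_⟩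
  ext v
  simp only [AlgHom.toLinearMap_apply, heckeAction_apply, MulOpposite.unop_op, heckeSMul_smul_left,
    Submodule.coe_smul]
  rw [heckeOp_eq_inv_ncard_smul, Submodule.coe_smul]

/-- THE IMAGE OF `H(G, K)` IN `End_k(V^K)` IS THE SPAN OF THE OPERATORS `e_K ρ(g) e_K`, `g ∈ G`
(characteristic `0`, `ρ` `K`-finite, every double coset a finite union of left cosets). -/
theorem range_heckeAction_eq_span_heckeOp (hK : KFinite ρ K)
    (hfin : ∀ ω : orbitRel.Quotient K (G ⧸ K), ω.orbit.Finite) :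
    LinearMap.range (heckeAction ρ (K := K)).toLinearMap =
      Submodule.span k (Set.range (heckeOp ρ hK)) := by
  apply le_antisymm
  · rintro _ ⟨T, rfl⟩
    simp only [AlgHom.toLinearMap_apply]
    have hmem : T.unop ∈ Submodule.span k (Set.range (heckeAlgebraBasis' k K hfin)) := by
      rw [(heckeAlgebraBasis' k K hfin).span_eq]
      exact Submodule.mem_top
    have key : ∀ S ∈ Submodule.span k (Set.range (heckeAlgebraBasis' k K hfin)),
        heckeAction ρ (MulOpposite.op S) ∈ Submodule.span k (Set.range (heckeOp ρ hK)) := by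
      intro S hS
      induction hS using Submodule.span_induction with
      | mem S hS =>
        obtain ⟨ω, rfl⟩ := hS
        obtain ⟨g, hg⟩ := exists_orbit_eq ω
        show heckeEnd ρ (heckeAlgebraBasis' k K hfin ω) ∈ _
        rw [heckeEnd_heckeAlgebraBasis' ρ hK hfin ω g hg]
        exact Submodule.smul_mem _ _ (Submodule.subset_span ⟨g, rfl⟩)
      | zero => simp
      | add x y _ _ hx hy =>
        rw [MulOpposite.op_add, map_add]
        exact Submodule.add_mem _ hx hy
      | smul a x _ hx =>
        rw [MulOpposite.op_smul, map_smul]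
        exact Submodule.smul_mem _ _ hx
    have := key T.unop hmem
    rwa [MulOpposite.op_unop] at this
  · rw [Submodule.span_le]
    rintro _ ⟨g, rfl⟩
    haveI : Finite (orbit K (g : G ⧸ K)) := by
      have := hfin (Quotient.mk'' (g : G ⧸ K))
      rw [orbitRel.Quotient.orbit_mk] at this
      exact this
    exact heckeOp_mem_range_heckeAction ρ hK g

end

end Summit.Ventures.HodgeRepro2.T5HeckeActionRange
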